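import Mathlib
import Summits.ValiantsHypothesis.ValiantsHypothesis.Theorems.FifoMatchingNNDivisionHardZonotopeTransport
import Summits.ValiantsHypothesis.ValiantsHypothesis.Theorems.FifoMatchingNNDivisionHardFewGeneratorsExp
import HarnessLib

/-!
# ★★★ `NNDivisionHard` ON COFACTORS WHOSE NEWTON POLYTOPE IS A ZONOTOPE WITH POLYNOMIALLY MANY ZONES — e.g. ALL products of
# powers of binomials / univariate / collinear-support polynomials (crux `Theses.FifoMatching.NNDivisionHard`, stmt-ValiantsHypothesis-21181)

WHAT IS NEW.  The named survivor of every NN-currency tier of the tree (leafhand-8-g1's census; dimension tier ✓ `…LowDimRate`, generator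
count ✓ `…FewGeneratorsExp`, parallel flats ✓ `…FewFlatsExp`) is the ZONOTOPE-LIKE cofactor `hh = Π_i p_i` with few-nomial factors and MANY
factors — `k` binomial factors give `2^k` vertices and Newton dimension up to `k`.  Val-idea-41's FEW-ZONES LAW (✓ `…FaceBlindFewZones.fewZones_decided`,
in kernel, ARBITRARY zone vectors) read on `NN_n` through the zone-count transport (✓ `…ZonotopeTransport.nn_zonotope_fewZones`) decides
this class:

* `choose_ratio_pow_le`, `count_of_lt_two_pow` — the binomial bookkeeping of the few-zones condition `M·C(h−t−1,t−1) < C(h−1,t−1)`: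
  it follows from `M < 2^{⌊t/u⌋}` whenever `u(t−1) ≥ h−t` (Bernoulli: `(1+1/u)^u ≥ 2`);
* `poly_lt_two_pow_eventually`, `zones_threshold`, `zone_params` — at `t = ⌊h/m'⌋`, `m' = 2(log₂h+C)^C+4`, `u = 2m'`:
  `h^{4k} < 2^{⌊t/(2m')⌋}` as soon as `2m'²(4k(log₂h+1)+1) ≤ 2^{log₂ h}`, which holds eventually in `h`;
* ★★★ `nnDivisionHard_zonotope` — for all `c k`, eventually in `n`: every `hh ≠ 0` over `ℝ≥0` whose Newton polytope is a zonotope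
  `conv{w + Σ_{i∈S} gen i : S ⊆ [M]}` with `M ≤ n^k` zones (ANY zone vectors `gen i`) satisfies the crux's literal inequality
  `2^((log₂ n + c)^c) < L₊(NN_n · hh) + L₊(hh)`.  Members (`Newt` of a product = Minkowski sum of the factors' Newton polytopes):
  `hh = x^w · Π_{i<M} p_i` with every `supp p_i` COLLINEAR (binomials `a x^α + b x^β`, univariate `p_i(x_e)`, `p_i(x^v)`), `M ≤ n^k`
  factors, any degrees — e.g. `Π_e (1 + x_e)^{D_e}` over ALL `4n²` arcs (`2^{4n²}` vertices, full Newton dimension: in no earlier tier).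

HONEST FRAMING: a restriction theorem (a decided sub-class of cofactors), NOT the crux: stmt-21181 `NNDivisionHard` OPEN — survivors must now
ALSO fail to have a zonotopal Newton polytope with `n^{O(1)}` zones (e.g. products of many TRIANGLE-supported factors); `CovZonoHard` /
COR-VIRTUAL OPEN; `NNNotVP` OPEN; `VP ≠ VNP` NOT proved.  No definitions, no named facts, no sorry.
References: Hrubeš–Yehudayoff 2021 §6 Problem 2 [HrubesYehudayoff2021]; Kaibel–Weltge 2015 [KaibelWeltge2014]; Fiorini et al. 2015 [FioriniEtAl2015].
-/

set_option autoImplicit false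

-- the mandated summit-side namespace repeats a component by design (single-problem summit)
set_option linter.dupNamespace false

noncomputable section

open Matrix Finset Filter Topology
open scoped Pointwise

namespace Summit.ValiantsHypothesis.ValiantsHypothesis.Theorems.FifoMatching

namespace Zono

open Literature.Barriers.PneNP (HasEFOfSize)
open MvPolynomial
open scoped NNReal
open Literature.Computability.AlgebraicComplexity (complexity nestFreeMatchingPoly)
open Literature.Computability.AlgebraicComplexity.MonotoneCircuitEF (hasEFOfSize_newtonPolytope_complexity)
open Literature.Algebra.Polynomial.NewtonPolytope (newtonPolytope newtonPolytope_mul)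
open Summit.ValiantsHypothesis.ValiantsHypothesis.Theorems.FifoMatching.XcDivision (T_pow_four_le)

/-! ## §1 Binomial bookkeeping for the few-zones condition -/

/-- `C(a+j, k) ≥ C(a, k) · ((a+s)/(a+s−k))^j` for `j ≤ s`, `k ≤ a`: each step `C(a+j+1,k) = C(a+j,k)·(a+j+1)/(a+j+1−k)` gains at
least the LAST ratio `(a+s)/(a+s−k)`. [folklore] -/
theorem choose_ratio_pow_le (a k s : ℕ) (hk : k ≤ a) : ∀ j : ℕ, j ≤ s →
    (Nat.choose a k : ℝ) * (((a + s : ℕ) : ℝ) / ((a + s - k : ℕ) : ℝ)) ^ j ≤ (Nat.choose (a + j) k : ℝ) := by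
  intro j
  induction j with
  | zero => intro _; simp
  | succ j ih =>
    intro hj
    have hj' : j ≤ s := by omega
    have hih := ih hj'
    -- the defining identity, cast to `ℝ`
    have hid : (Nat.choose (a + j) k : ℝ) * ((a + j : ℕ) + 1 : ℝ) =
        (Nat.choose (a + j + 1) k : ℝ) * ((a + j + 1 - k : ℕ) : ℝ) := by
      have := Nat.choose_mul_succ_eq (a + j) k
      exact_mod_cast this
    have hden : (0 : ℝ) < ((a + j + 1 - k : ℕ) : ℝ) := by exact_mod_cast (show 0 < a + j + 1 - k by omega)
    have hden' : (0 : ℝ) < ((a + s - k : ℕ) : ℝ) := by exact_mod_cast (show 0 < a + s - k by omega)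
    have hρ : ((a + s : ℕ) : ℝ) / ((a + s - k : ℕ) : ℝ) ≤ ((a + j : ℕ) + 1 : ℝ) / ((a + j + 1 - k : ℕ) : ℝ) := by
      rw [div_le_div_iff₀ hden' hden]
      have e1 : (((a + s - k : ℕ) : ℝ)) = (a : ℝ) + s - k := by
        rw [Nat.cast_sub (by omega)]; push_cast; ring
      have e2 : (((a + j + 1 - k : ℕ) : ℝ)) = (a : ℝ) + j + 1 - k := by
        rw [Nat.cast_sub (by omega)]; push_cast; ring
      rw [e1, e2]
      push_cast
      have hjs : (j : ℝ) + 1 ≤ s := by exact_mod_cast (show j + 1 ≤ s by omega)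
      have hk0 : (0 : ℝ) ≤ k := Nat.cast_nonneg k
      nlinarith
    have hρ0 : (0 : ℝ) ≤ ((a + s : ℕ) : ℝ) / ((a + s - k : ℕ) : ℝ) := by positivity
    have hC0 : (0 : ℝ) ≤ (Nat.choose (a + j) k : ℝ) := Nat.cast_nonneg _
    -- `C(a+j+1,k) = C(a+j,k)·(a+j+1)/(a+j+1−k) ≥ C(a+j,k)·ρ ≥ C(a,k)·ρ^{j+1}`
    have hstep : (Nat.choose (a + j) k : ℝ) * (((a + s : ℕ) : ℝ) / ((a + s - k : ℕ) : ℝ)) ≤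
        (Nat.choose (a + j + 1) k : ℝ) := by
      have h1 : (Nat.choose (a + j) k : ℝ) * (((a + s : ℕ) : ℝ) / ((a + s - k : ℕ) : ℝ)) ≤
          (Nat.choose (a + j) k : ℝ) * (((a + j : ℕ) + 1 : ℝ) / ((a + j + 1 - k : ℕ) : ℝ)) :=
        mul_le_mul_of_nonneg_left hρ hC0
      have h2 : (Nat.choose (a + j) k : ℝ) * (((a + j : ℕ) + 1 : ℝ) / ((a + j + 1 - k : ℕ) : ℝ)) =
          (Nat.choose (a + j + 1) k : ℝ) := by
        rw [mul_div_assoc', div_eq_iff hden.ne', ← hid]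
      linarith
    have : (a + (j + 1)) = a + j + 1 := by ring
    rw [this, pow_succ, ← mul_assoc]
    exact le_trans (mul_le_mul_of_nonneg_right hih hρ0) hstep

/-- ★ **the few-zones count from an exponential bound**: for `2 ≤ t`, `2t ≤ h`, `1 ≤ u`, `h − t ≤ u(t−1)` and `M < 2^{⌊t/u⌋}`:
`M·C(h−t−1, t−1) < C(h−1, t−1)` (since `C(h−1,t−1)/C(h−t−1,t−1) ≥ ((h−1)/(h−t))^t ≥ (1+1/u)^t ≥ 2^{⌊t/u⌋}`). [folklore] -/
theorem count_of_lt_two_pow {h t u M : ℕ} (ht : 2 ≤ t) (hth : 2 * t ≤ h) (hu : 1 ≤ u) (hut : h - t ≤ u * (t - 1))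
    (hM : M < 2 ^ (t / u)) : M * Nat.choose (h - t - 1) (t - 1) < Nat.choose (h - 1) (t - 1) := by
  -- `a = h - t - 1`, `k = t - 1`, `s = t`: `a + s = h - 1`, `a + s - k = h - t`
  have hmain := choose_ratio_pow_le (h - t - 1) (t - 1) t (by omega) t le_rfl
  have e1 : h - t - 1 + t = h - 1 := by omega
  rw [e1] at hmain
  have e2 : h - 1 - (t - 1) = h - t := by omega
  rw [e2] at hmain
  -- the ratio `(h-1)/(h-t) ≥ 1 + 1/u`
  have hht : (0 : ℝ) < ((h - t : ℕ) : ℝ) := by exact_mod_cast (show 0 < h - t by omega)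
  have huR : (1 : ℝ) ≤ u := by exact_mod_cast hu
  have hratio : (1 : ℝ) + 1 / u ≤ ((h - 1 : ℕ) : ℝ) / ((h - t : ℕ) : ℝ) := by
    rw [le_div_iff₀ hht]
    have e3 : ((h - 1 : ℕ) : ℝ) = ((h - t : ℕ) : ℝ) + ((t - 1 : ℕ) : ℝ) := by
      rw [← Nat.cast_add]; congr 1; omega
    rw [e3, add_mul, one_mul, add_le_add_iff_left, div_mul_eq_mul_div, one_mul, div_le_iff₀ (by linarith)]
    have : ((h - t : ℕ) : ℝ) ≤ ((u * (t - 1) : ℕ) : ℝ) := by exact_mod_cast hut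
    push_cast at this
    linarith
  -- Bernoulli: `2 ≤ (1 + 1/u)^u`
  have hinv0 : (0 : ℝ) ≤ 1 / u := by positivity
  have hbern : (2 : ℝ) ≤ (1 + 1 / u) ^ u := by
    have hb := one_add_mul_le_pow (show (-2 : ℝ) ≤ 1 / u by linarith) u
    have hu1 : (u : ℝ) * (1 / u) = 1 := by field_simp
    linarith
  have hone : (1 : ℝ) ≤ 1 + 1 / u := by linarith
  -- `2^{t/u} ≤ (1+1/u)^{u (t/u)} ≤ (1+1/u)^t ≤ ((h-1)/(h-t))^t`
  have hchain : ((2 : ℝ) ^ (t / u)) ≤ (((h - 1 : ℕ) : ℝ) / ((h - t : ℕ) : ℝ)) ^ t :=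
    calc (2 : ℝ) ^ (t / u) ≤ ((1 + 1 / u) ^ u) ^ (t / u) := pow_le_pow_left₀ (by norm_num) hbern _
      _ = (1 + 1 / u) ^ (u * (t / u)) := (pow_mul _ _ _).symm
      _ ≤ (1 + 1 / u) ^ t := pow_le_pow_right₀ hone (Nat.mul_div_le t u)
      _ ≤ (((h - 1 : ℕ) : ℝ) / ((h - t : ℕ) : ℝ)) ^ t := pow_le_pow_left₀ (by positivity) hratio t
  have hMR : (M : ℝ) < (2 : ℝ) ^ (t / u) := by exact_mod_cast hM
  have hC0 : (0 : ℝ) < (Nat.choose (h - t - 1) (t - 1) : ℝ) := by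
    exact_mod_cast Nat.choose_pos (by omega)
  have key : (M : ℝ) * (Nat.choose (h - t - 1) (t - 1) : ℝ) < (Nat.choose (h - 1) (t - 1) : ℝ) := by
    calc (M : ℝ) * (Nat.choose (h - t - 1) (t - 1) : ℝ)
        < (2 : ℝ) ^ (t / u) * (Nat.choose (h - t - 1) (t - 1) : ℝ) := mul_lt_mul_of_pos_right hMR hC0
      _ ≤ (((h - 1 : ℕ) : ℝ) / ((h - t : ℕ) : ℝ)) ^ t * (Nat.choose (h - t - 1) (t - 1) : ℝ) :=
          mul_le_mul_of_nonneg_right hchain hC0.le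
      _ = (Nat.choose (h - t - 1) (t - 1) : ℝ) * (((h - 1 : ℕ) : ℝ) / ((h - t : ℕ) : ℝ)) ^ t := mul_comm _ _
      _ ≤ (Nat.choose (h - 1) (t - 1) : ℝ) := hmain
  exact_mod_cast key

/-! ## §2 The threshold: polynomially many zones fit under the count, eventually in `h` -/

/-- `(ℓ + B)^D < 2^ℓ` eventually in `ℓ`. [folklore] -/
theorem poly_lt_two_pow_eventually (B D : ℕ) : ∃ N : ℕ, ∀ ℓ ≥ N, (ℓ + B) ^ D < 2 ^ ℓ := by
  have h1 : Tendsto (fun ℓ : ℕ => (((ℓ + B : ℕ) : ℝ)) ^ D / 2 ^ (ℓ + B)) atTop (𝓝 0) :=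
    (tendsto_pow_const_div_const_pow_of_one_lt D (one_lt_two : (1 : ℝ) < 2)).comp (tendsto_add_atTop_nat B)
  have h2 : Tendsto (fun ℓ : ℕ => (2 : ℝ) ^ B * ((((ℓ + B : ℕ) : ℝ)) ^ D / 2 ^ (ℓ + B))) atTop (𝓝 0) := by
    simpa using h1.const_mul ((2 : ℝ) ^ B)
  have h3 : ∀ᶠ ℓ : ℕ in atTop, (2 : ℝ) ^ B * ((((ℓ + B : ℕ) : ℝ)) ^ D / 2 ^ (ℓ + B)) < 1 :=
    h2.eventually_lt_const one_pos
  obtain ⟨N, hN⟩ := Filter.eventually_atTop.1 h3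
  refine ⟨N, fun ℓ hℓ => ?_⟩
  have h4 := hN ℓ hℓ
  have e : (2 : ℝ) ^ B * ((((ℓ + B : ℕ) : ℝ)) ^ D / 2 ^ (ℓ + B)) = (((ℓ + B : ℕ) : ℝ)) ^ D / 2 ^ ℓ := by
    rw [pow_add]; field_simp
  rw [e, div_lt_one (by positivity)] at h4
  exact_mod_cast h4

/-- ★ **the threshold**: for all `C k`, eventually in `ℓ = log₂ h`: `2·m'²·(4k(ℓ+1)+1) ≤ 2^ℓ` with `m' = 2(ℓ+C)^C+4`. [folklore] -/
theorem zones_threshold (C k : ℕ) : ∃ N : ℕ, ∀ ℓ ≥ N,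
    2 * (2 * (ℓ + C) ^ C + 4) ^ 2 * (4 * k * (ℓ + 1) + 1) ≤ 2 ^ ℓ := by
  obtain ⟨N, hN⟩ := poly_lt_two_pow_eventually (C + 4 * k + 72) (2 * C + 3)
  refine ⟨N, fun ℓ hℓ => le_of_lt (lt_of_le_of_lt ?_ (hN ℓ hℓ))⟩
  set b : ℕ := ℓ + (C + 4 * k + 72) with hb
  have hb1 : 1 ≤ b := by omega
  have hpow1 : 1 ≤ b ^ C := Nat.one_le_pow _ _ hb1
  have h1 : (ℓ + C) ^ C ≤ b ^ C := Nat.pow_le_pow_left (by omega) C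
  have hm : 2 * (ℓ + C) ^ C + 4 ≤ 6 * b ^ C := by omega
  have h2 : 4 * k * (ℓ + 1) + 1 ≤ b * b := by
    have : 4 * k * (ℓ + 1) + 1 ≤ (4 * k + 1) * (ℓ + 1) := by nlinarith
    exact this.trans (Nat.mul_le_mul (by omega) (by omega))
  calc 2 * (2 * (ℓ + C) ^ C + 4) ^ 2 * (4 * k * (ℓ + 1) + 1)
      ≤ 2 * (6 * b ^ C) ^ 2 * (b * b) := Nat.mul_le_mul (Nat.mul_le_mul_left 2 (Nat.pow_le_pow_left hm 2)) h2
    _ = 72 * b ^ (2 * C + 2) := by ring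
    _ ≤ b * b ^ (2 * C + 2) := Nat.mul_le_mul_right _ (by omega)
    _ = b ^ (2 * C + 3) := by ring

/-- ★ **the zone parameters**: if `2^N ≤ h` with `N` the threshold of `zones_threshold C k`, `n < h^4` and `M ≤ n^k`, then
`t = ⌊h/m'⌋`, `m' = 2(log₂h+C)^C+4`, satisfies the three hypotheses of the few-zones law. [folklore] -/
theorem zone_params {C k N h n M : ℕ}
    (hN : ∀ ℓ ≥ N, 2 * (2 * (ℓ + C) ^ C + 4) ^ 2 * (4 * k * (ℓ + 1) + 1) ≤ 2 ^ ℓ)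
    (hhN : 2 ^ N ≤ h) (hn4 : n < h ^ 4) (hMk : M ≤ n ^ k) :
    ∃ t : ℕ, 1 ≤ t ∧ (2 * (Nat.log 2 h + C) ^ C + 4) * t ≤ h ∧
      M * Nat.choose (h - t - 1) (t - 1) < Nat.choose (h - 1) (t - 1) := by
  have hh0' : h ≠ 0 := by
    have : 1 ≤ 2 ^ N := Nat.one_le_two_pow
    omega
  have hℓN : N ≤ Nat.log 2 h := Nat.le_log_of_pow_le (by norm_num) hhN
  have hthr := hN (Nat.log 2 h) hℓN
  have h2ℓ : 2 ^ Nat.log 2 h ≤ h := Nat.pow_log_le_self 2 hh0'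
  have hm'6 : 6 ≤ 2 * (Nat.log 2 h + C) ^ C + 4 := by
    have : 1 ≤ (Nat.log 2 h + C) ^ C :=
      Summit.ValiantsHypothesis.ValiantsHypothesis.Theorems.FifoMatching.FaceBlind.one_le_L h C
    omega
  -- abbreviations as plain variables (no `set`, to keep `omega`/`whnf` cheap)
  obtain ⟨m', hm'⟩ : ∃ m', m' = 2 * (Nat.log 2 h + C) ^ C + 4 := ⟨_, rfl⟩
  obtain ⟨X, hX⟩ : ∃ X, X = 4 * k * (Nat.log 2 h + 1) + 1 := ⟨_, rfl⟩
  rw [← hm'] at hm'6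
  rw [← hm', ← hX] at hthr
  have hA : (2 * m' * X) * m' ≤ h := by
    calc (2 * m' * X) * m' = 2 * m' ^ 2 * X := by ring
      _ ≤ 2 ^ Nat.log 2 h := hthr
      _ ≤ h := h2ℓ
  obtain ⟨t, htdef⟩ : ∃ t, t = h / m' := ⟨_, rfl⟩
  have ht_ge : 2 * m' * X ≤ t := by
    rw [htdef]; exact (Nat.le_div_iff_mul_le (by omega)).2 hA
  have hX1 : 1 ≤ X := by omega
  have ht3 : 3 ≤ t := le_trans (by nlinarith) ht_ge
  have hmt : m' * t ≤ h := by rw [htdef]; exact Nat.mul_div_le h m'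
  have h2t : 2 * t ≤ h := le_trans (Nat.mul_le_mul_right t (show 2 ≤ m' by omega)) hmt
  have hlt_mt : h < m' * t + m' := by
    rw [htdef]
    have := Nat.lt_mul_div_succ h (show 0 < m' by omega)
    rw [Nat.mul_succ] at this
    exact this
  have hut : h - t ≤ 2 * m' * (t - 1) := by
    have e : 2 * m' * (t - 1) = 2 * m' * t - 2 * m' := Nat.mul_sub_one (2 * m') t
    rw [e]
    have h3m : 3 * m' ≤ m' * t := by nlinarith
    have e2 : 2 * m' * t = 2 * (m' * t) := by ring
    rw [e2]
    omega
  -- the zone count: `M ≤ n^k ≤ h^{4k} ≤ 2^{4k(ℓ+1)} < 2^X ≤ 2^{t/(2m')}`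
  have hcountM : M < 2 ^ (t / (2 * m')) := by
    have hq : X ≤ t / (2 * m') := (Nat.le_div_iff_mul_le (by omega)).2 (by
      calc X * (2 * m') = 2 * m' * X := by ring
        _ ≤ t := ht_ge)
    have hhℓ : h < 2 ^ (Nat.log 2 h + 1) := Nat.lt_pow_succ_log_self (by norm_num) h
    have hM1 : M ≤ (h ^ 4) ^ k := hMk.trans (Nat.pow_le_pow_left hn4.le k)
    have hM2 : (h ^ 4) ^ k ≤ (2 ^ (Nat.log 2 h + 1)) ^ (4 * k) := by
      rw [← pow_mul]
      exact Nat.pow_le_pow_left hhℓ.le _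
    have hM3 : (2 ^ (Nat.log 2 h + 1)) ^ (4 * k) < 2 ^ X := by
      rw [← pow_mul, hX]
      apply Nat.pow_lt_pow_right (by norm_num)
      have : (Nat.log 2 h + 1) * (4 * k) = 4 * k * (Nat.log 2 h + 1) := by ring
      omega
    calc M ≤ (h ^ 4) ^ k := hM1
      _ ≤ (2 ^ (Nat.log 2 h + 1)) ^ (4 * k) := hM2
      _ < 2 ^ X := hM3
      _ ≤ 2 ^ (t / (2 * m')) := Nat.pow_le_pow_right (by norm_num) hq
  have hcount := count_of_lt_two_pow (by omega) h2t (by omega : 1 ≤ 2 * m') hut hcountM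
  refine ⟨t, by omega, ?_, hcount⟩
  rw [← hm']; exact hmt

/-! ## §3 In the crux's currency -/

/-- ★★★ **`NNDivisionHard` ON THE COFACTORS WHOSE NEWTON POLYTOPE IS A ZONOTOPE WITH POLYNOMIALLY MANY ZONES (PROVED, unconditional):**
for all `c k`, eventually in `n`, every `hh ≠ 0` over `ℝ≥0` whose Newton polytope is `conv{w + Σ_{i∈S} gen i : S ⊆ [M]}` with `M ≤ n^k`
(ANY zone vectors `gen i : ℝ^{2n×2n}`, any `w`) satisfies `2^((log₂ n + c)^c) < L₊(NN_n · hh) + L₊(hh)`.  Members: `x^w · Π_{i<M} p_i`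
with collinear `supp p_i` (binomial / univariate / `p_i(x^v)` factors), any degrees, `M ≤ n^k`.
[cite: HrubesYehudayoff2021, §6 Problem 2] [cite: KaibelWeltge2014, Thm. 1] -/
theorem nnDivisionHard_zonotope (c k : ℕ) : ∃ n₀ : ℕ, ∀ n ≥ n₀,
    ∀ hh : MvPolynomial (Fin (2 * n) × Fin (2 * n)) ℝ≥0, hh ≠ 0 →
      ∀ {M : ℕ} (gen : Fin M → (Fin (2 * n) × Fin (2 * n)) → ℝ) (w : (Fin (2 * n) × Fin (2 * n)) → ℝ),
        newtonPolytope (MvPolynomial.map NNReal.toRealHom hh) =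
          convexHull ℝ (Set.range fun S : Finset (Fin M) => w + ∑ i ∈ S, gen i) →
        M ≤ n ^ k →
          2 ^ ((Nat.log 2 n + c) ^ c) < complexity (nestFreeMatchingPoly n ℝ≥0 * hh) + complexity hh := by
  obtain ⟨cA, hcA, t₀, htrans⟩ := nn_zonotope_fewZones
  set cm : ℝ := min cA 1 with hcm
  have hcm0 : 0 < cm := lt_min hcA one_pos
  have hcmA : cm ≤ cA := min_le_left _ _
  have hcm1 : cm ≤ 1 := min_le_right _ _
  obtain ⟨N, hN⟩ := zones_threshold (4 ^ (c + 1) + c + 1) k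
  obtain ⟨S₁, hS₁⟩ := exists_nat_ge ((20 / cm) ^ 2)
  obtain ⟨S₀, hS₀a, hS₀b, hS₀c, hS₀d⟩ :
      ∃ S₀ : ℕ, 4 * t₀ + 4 ≤ S₀ ∧ (2 ^ N) ^ 2 ≤ S₀ ∧ S₁ ≤ S₀ ∧ 16 ≤ S₀ :=
    ⟨4 * t₀ + 4 + (2 ^ N) ^ 2 + S₁ + 16, by omega, by omega, by omega, by omega⟩
  refine ⟨S₀ ^ 2, fun n hn hh hh0 M gen w hQ hMk => ?_⟩
  classical
  by_contra hle
  push Not at hle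
  have hEF : HasEFOfSize (newtonPolytope (MvPolynomial.map NNReal.toRealHom (nestFreeMatchingPoly n ℝ≥0)) +
      convexHull ℝ (Set.range fun S : Finset (Fin M) => w + ∑ i ∈ S, gen i)) (3 * 2 ^ ((Nat.log 2 n + c) ^ c)) := by
    have h1 := hasEFOfSize_newtonPolytope_complexity (nestFreeMatchingPoly n ℝ≥0 * hh)
    rw [map_mul, newtonPolytope_mul, hQ] at h1
    exact h1.of_le (by omega)
  obtain ⟨s, hs⟩ : ∃ s, s = Nat.sqrt n := ⟨_, rfl⟩
  have hsS : S₀ ≤ s := by rw [hs]; exact Nat.le_sqrt'.2 hn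
  have hss : s ^ 2 ≤ n := by rw [hs]; exact Nat.sqrt_le' n
  have hns : n < (s + 1) ^ 2 := by rw [hs]; exact Nat.lt_succ_sqrt' n
  obtain ⟨g, hg⟩ : ∃ g, g = s / 4 := ⟨_, rfl⟩
  have h4g : 4 * g ≤ s := by rw [hg]; exact Nat.mul_div_le s 4
  have hg4 : s < 4 * (g + 1) := by rw [hg]; omega
  have hg1 : 1 ≤ g := by omega
  have hgt : t₀ ≤ g := by omega
  have hn' : (2 * g + 1) * (2 * (2 * g) + 1) ≤ n := by nlinarith [Nat.mul_le_mul h4g h4g]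
  obtain ⟨h, hch, hlaw⟩ := htrans n (2 * g) g (by omega) hn' (le_refl _) hgt gen w _ hEF
  -- `h` is large
  have hsqrt_s : Real.sqrt s * Real.sqrt s = s := Real.mul_self_sqrt (Nat.cast_nonneg s)
  have hg_real : (s : ℝ) / 4 - 1 ≤ g := by
    have : (s : ℝ) < 4 * ((g : ℝ) + 1) := by exact_mod_cast hg4
    linarith
  have h1 : cm * ((s : ℝ) / 4 - 1) ≤ h :=
    calc cm * ((s : ℝ) / 4 - 1) ≤ cm * g := mul_le_mul_of_nonneg_left hg_real hcm0.le
      _ ≤ cA * g := mul_le_mul_of_nonneg_right hcmA (Nat.cast_nonneg g)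
      _ ≤ h := hch
  have hreal : Real.sqrt s + 1 ≤ (h : ℝ) := by
    have hS₁s : ((20 / cm) ^ 2 : ℝ) ≤ s := le_trans hS₁ (by exact_mod_cast (show S₁ ≤ s by omega))
    have hsq : 20 / cm ≤ Real.sqrt s := by
      rw [show (20 / cm : ℝ) = Real.sqrt ((20 / cm) ^ 2) by rw [Real.sqrt_sq (by positivity)]]
      exact Real.sqrt_le_sqrt hS₁s
    have h20 : 20 ≤ cm * Real.sqrt s := by
      have := mul_le_mul_of_nonneg_left hsq hcm0.le
      rwa [show cm * (20 / cm) = 20 by field_simp] at this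
    have h2 : 20 * Real.sqrt s ≤ cm * s := by
      have := mul_le_mul_of_nonneg_right h20 (Real.sqrt_nonneg s)
      rw [mul_assoc, hsqrt_s] at this
      exact this
    have hs1 : 1 ≤ Real.sqrt s := by
      rw [show (1 : ℝ) = Real.sqrt 1 by simp]
      exact Real.sqrt_le_sqrt (by exact_mod_cast (show 1 ≤ s by omega))
    nlinarith
  have hhN : 2 ^ N ≤ h := by
    have : ((2 ^ N : ℕ) : ℝ) ≤ Real.sqrt s := by
      rw [show ((2 ^ N : ℕ) : ℝ) = Real.sqrt (((2 ^ N : ℕ) : ℝ) ^ 2) by rw [Real.sqrt_sq (Nat.cast_nonneg _)]]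
      exact Real.sqrt_le_sqrt (by exact_mod_cast (show (2 ^ N) ^ 2 ≤ s by omega))
    exact_mod_cast (by linarith : ((2 ^ N : ℕ) : ℝ) ≤ h)
  have hn4 : n < h ^ 4 := by
    have hs1 : s + 1 ≤ h ^ 2 := by
      have : (s : ℝ) + 1 ≤ (h : ℝ) ^ 2 := by nlinarith [Real.sqrt_nonneg s]
      exact_mod_cast this
    calc n < (s + 1) ^ 2 := hns
      _ ≤ (h ^ 2) ^ 2 := Nat.pow_le_pow_left hs1 2
      _ = h ^ 4 := by rw [← pow_mul]
  have hn0 : n ≠ 0 := by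
    have : 16 ^ 2 ≤ s ^ 2 := Nat.pow_le_pow_left (by omega) 2
    omega
  -- the zone parameters and the few-zones law
  obtain ⟨t, ht1, hmt, hcount⟩ := zone_params (C := 4 ^ (c + 1) + c + 1) hN hhN hn4 hMk
  have hlt := hlaw (4 ^ (c + 1) + c + 1) t ht1 hmt hcount
  have hT := T_pow_four_le (c := c) hn0 hn4
  have hT2 : 2 ≤ 2 ^ ((Nat.log 2 n + c) ^ c) := by
    show 2 ^ 1 ≤ 2 ^ _
    exact Nat.pow_le_pow_right (by norm_num)
      (Nat.one_le_pow _ _ (by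
        have h256 : 16 ^ 2 ≤ S₀ ^ 2 := Nat.pow_le_pow_left hS₀d 2
        have := Nat.log_pos one_lt_two (show 2 ≤ n by omega)
        omega))
  have h8 : 8 * 2 ^ ((Nat.log 2 n + c) ^ c) ≤ (2 ^ ((Nat.log 2 n + c) ^ c)) ^ 4 := by
    have : 2 ^ 3 ≤ (2 ^ ((Nat.log 2 n + c) ^ c)) ^ 3 := Nat.pow_le_pow_left hT2 3
    calc 8 * 2 ^ ((Nat.log 2 n + c) ^ c) = 2 ^ 3 * 2 ^ ((Nat.log 2 n + c) ^ c) := by norm_num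
      _ ≤ (2 ^ ((Nat.log 2 n + c) ^ c)) ^ 3 * 2 ^ ((Nat.log 2 n + c) ^ c) := Nat.mul_le_mul_right _ this
      _ = (2 ^ ((Nat.log 2 n + c) ^ c)) ^ 4 := by ring
  omega

end Zono

end Summit.ValiantsHypothesis.ValiantsHypothesis.Theorems.FifoMatching

end
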